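import Mathlib
import HarnessLib
import Literature.NumberTheory.LFunctions.ZetaScrew
import Literature.NumberTheory.LFunctions.ZetaScrewThm41Proofs
import Summits.RiemannHypothesis.RiemannHypothesis.Theorems.IntegerScrewHingeCarrier
import Summits.RiemannHypothesis.RiemannHypothesis.Theorems.IntegerScrewIncrementCovLag

/-!
# Route `IntegerScrew` — the HINGE RESONANCE of the increment covariances:
# `M·Cov(I_M, I_{M/n}) → −Λ(n)/√n` along `n ∣ M` (PIVOT-LAW §2d, DERIVED → THEOREM; RH-FREE)

`IntegerScrewIncrementCovLag` gives the LOCAL structure of the increments of Kreĭn's screw line at the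
corner (`M·Cov(I_M, I_{M−k}) → c_k/2`).  This file gives the ARITHMETIC structure: the increment
`I_r = x_{log r} − x_{log(r−1)}` at the divisor node `r = M/n` resonates with `I_M` through the hinge of
`Ψ` at `log n` (`IntegerScrewHingeCarrier`: `Ψ = Ψ_wall − φ`, `φ(t) = Σ_{m ≤ e^t} Λ(m)m^{−1/2}(t − log m)`
piecewise affine with slope jumps `Λ(m)/√m`, `Ψ_wall ∈ C¹(0,∞)`).  With
`Cov(I_M, I_m) = Ψ(log(M/(m−1))) + Ψ(log((M−1)/m)) − Ψ(log(M/m)) − Ψ(log((M−1)/(m−1)))` (the mixed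
second difference of `Ψ` over the lag cell, PIVOT-LAW §2a(iv)) and the carrier `m = ⌈M/n⌉`:

* `primeSum_mixed_eq` : the prime-sum part is EXACT — `φ(P₁) + φ(P₂) − φ(P₃) − φ(P₄) = (Λ(n)/√n)·log(M/(M−1))`
  for `M = n r + j`, `1 ≤ j ≤ n`, `r ≥ n`, carrier `r + 1 = ⌈M/n⌉` (the kink at `log n` is interior
  to that ONE cell for every residue `j`; the hinge mass is never split between two increments);
* `wallPsi_mixed_le` : the wall part is `o(1/M)` — for every `ε > 0`, small cells near `ℓ`:
  `|Ψ_wall(x+a) + Ψ_wall(x−b) − Ψ_wall(x) − Ψ_wall(x+a−b)| ≤ ε·a` (uniform continuity of `Ψ_wall'`);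
* **`tendsto_hingeCov`** : for every `n ≥ 2` and `1 ≤ j ≤ n`, with `M = n r + j`:
  `M·Cov(I_M, I_{⌈M/n⌉}) → −Λ(n)/√n` as `r → ∞` (`= 0` unless `n` is a prime power: only prime-power
  ratios resonate); `tendsto_hingeCov_dvd` is the re-indexed case `n ∣ M` (carrier `I_{M/n}`).

So at order `1/M` the newest increment correlates only with its neighbours (universal profile `c_k/2`)
and with the increments at `M/p^j` (amplitude `−log p/p^{j/2}`): the «hinge carrier» of the pivot law
in sharp form.  A statement about the explicit function `Ψ`; nothing here bears on the truth of RH.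
[Suzuki2023, (1.1)]
-/

noncomputable section

-- D-0017: `Summit.<S>.<S>.…` is the designed namespace of a single-problem summit.
set_option linter.dupNamespace false

namespace Summit.RiemannHypothesis.RiemannHypothesis.Theorems.IntegerScrew

open Literature.NumberTheory.LFunctions Literature.NumberTheory.LFunctions.Suzuki2023Thm41
open Filter Set Finset
open scoped Topology

/-! ### `Ψ_wall'` is continuous on `(0, ∞)` -/

/-- `Ψ_wall' = wallPsi₁` is continuous on `(0,∞)` (closed form of `G`: `wallG_eq_closedForm`).
[folklore] -/
theorem continuousOn_wallPsi₁_Ioi : ContinuousOn wallPsi₁ (Ioi 0) := by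
  have hG : ContinuousOn (fun t : ℝ =>
      (Real.log (1 + Real.exp (-(t / 2))) - Real.log (1 - Real.exp (-(t / 2)))) / 2
        + Real.arctan (Real.exp (-(t / 2)))) (Ioi 0) := by
    have he : Continuous fun t : ℝ => Real.exp (-(t / 2)) := by fun_prop
    refine ContinuousOn.add (ContinuousOn.div_const (ContinuousOn.sub ?_ ?_) 2) ?_
    · exact (he.continuousOn.const_add 1 |>.log fun t _ => by positivity) |>.mono fun _ h => h
    · refine (ContinuousOn.log (continuousOn_const.sub he.continuousOn) fun t ht => ?_)
      have ht : (0 : ℝ) < t := ht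
      have : Real.exp (-(t / 2)) < 1 := by
        rw [Real.exp_lt_one_iff]; linarith
      linarith
    · exact (Real.continuous_arctan.comp he).continuousOn
  have hW : ContinuousOn (fun t : ℝ => 4 * Real.sinh (t / 2) - wallSlope / 2
      + ((Real.log (1 + Real.exp (-(t / 2))) - Real.log (1 - Real.exp (-(t / 2)))) / 2
        + Real.arctan (Real.exp (-(t / 2))))) (Ioi 0) := by
    refine ContinuousOn.add ?_ hG
    exact (Continuous.continuousOn (by fun_prop))
  refine hW.congr fun t ht => ?_
  rw [wallPsi₁, wallG_eq_closedForm (show (0 : ℝ) < t from ht)]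

/-! ### The wall part of a far mixed difference is `o(cell)` -/

/-- **Uniform smallness of the wall part.** For `ℓ > 0` and every `ε > 0` there is `δ > 0` such that
for all base points `x` with `|x − ℓ| ≤ δ` and all `0 ≤ a ≤ δ`, `0 ≤ b ≤ δ`:
`|Ψ_wall(x+a) + Ψ_wall(x−b) − Ψ_wall(x) − Ψ_wall(x+a−b)| ≤ ε·a`
(mean value along `s ↦ Ψ_wall(x+s) − Ψ_wall(x−b+s)`, whose derivative is `< ε` by uniform continuity
of `Ψ_wall'` on `[ℓ/2, 2ℓ]`). [folklore] -/
theorem wallPsi_mixed_le {ℓ : ℝ} (hℓ : 0 < ℓ) {ε : ℝ} (hε : 0 < ε) :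
    ∃ δ > 0, ∀ x a b : ℝ, |x - ℓ| ≤ δ → 0 ≤ a → a ≤ δ → 0 ≤ b → b ≤ δ →
      |wallPsi (x + a) + wallPsi (x - b) - wallPsi x - wallPsi (x + a - b)| ≤ ε * a := by
  -- uniform continuity of Ψ_wall' on K = [ℓ/2, 2ℓ]
  have hK : IsCompact (Icc (ℓ / 2) (2 * ℓ)) := isCompact_Icc
  have hKsub : Icc (ℓ / 2) (2 * ℓ) ⊆ Ioi 0 := fun x hx => lt_of_lt_of_le (by linarith) hx.1
  have huc := hK.uniformContinuousOn_of_continuous (continuousOn_wallPsi₁_Ioi.mono hKsub)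
  rw [Metric.uniformContinuousOn_iff] at huc
  obtain ⟨δ₀, hδ₀, hδ⟩ := huc ε hε
  refine ⟨min (δ₀ / 2) (ℓ / 4), lt_min (half_pos hδ₀) (by linarith), ?_⟩
  intro x a b hx ha0 ha hb0 hb
  have hxℓ : |x - ℓ| ≤ ℓ / 4 := hx.trans (min_le_right _ _)
  rw [abs_le] at hxℓ
  have haδ : a ≤ ℓ / 4 := ha.trans (min_le_right _ _)
  have hbδ : b ≤ ℓ / 4 := hb.trans (min_le_right _ _)
  have hbδ₀ : b < δ₀ := lt_of_le_of_lt (hb.trans (min_le_left _ _)) (by linarith)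
  -- the path G(s) = Ψ_wall(x+s) − Ψ_wall(x−b+s) on [0, a]
  set G : ℝ → ℝ := fun s => wallPsi (x + s) - wallPsi (x - b + s) with hGdef
  have hderiv : ∀ s ∈ Icc (0 : ℝ) a,
      HasDerivWithinAt G (wallPsi₁ (x + s) - wallPsi₁ (x - b + s)) (Icc 0 a) s := by
    intro s hs
    have h1 : HasDerivAt (fun s : ℝ => wallPsi (x + s)) (wallPsi₁ (x + s)) s :=
      HasDerivAt.comp_const_add x s (hasDerivAt_wallPsi_Ioi (show 0 < x + s by linarith [hs.1]))
    have h2 : HasDerivAt (fun s : ℝ => wallPsi (x - b + s)) (wallPsi₁ (x - b + s)) s :=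
      HasDerivAt.comp_const_add (x - b) s
        (hasDerivAt_wallPsi_Ioi (show 0 < x - b + s by linarith [hs.1]))
    exact (h1.sub h2).hasDerivWithinAt
  have hbound : ∀ s ∈ Icc (0 : ℝ) a, ‖wallPsi₁ (x + s) - wallPsi₁ (x - b + s)‖ ≤ ε := by
    intro s hs
    have hx' : x + s ∈ Icc (ℓ / 2) (2 * ℓ) := ⟨by linarith [hs.1], by linarith [hs.2]⟩
    have hy : x - b + s ∈ Icc (ℓ / 2) (2 * ℓ) := ⟨by linarith [hs.1], by linarith [hs.2]⟩
    have hd : dist (x + s) (x - b + s) < δ₀ := by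
      rw [Real.dist_eq, show x + s - (x - b + s) = b by ring, abs_of_nonneg hb0]; exact hbδ₀
    have := hδ (x + s) hx' (x - b + s) hy hd
    rw [Real.dist_eq] at this
    exact this.le
  have hmv := Convex.norm_image_sub_le_of_norm_hasDerivWithin_le hderiv hbound (convex_Icc 0 a)
    (Set.left_mem_Icc.2 ha0) (Set.right_mem_Icc.2 ha0)
  rw [Real.norm_eq_abs, Real.norm_eq_abs, sub_zero, abs_of_nonneg ha0] at hmv
  have e : G a - G 0 = wallPsi (x + a) + wallPsi (x - b) - wallPsi x - wallPsi (x + a - b) := by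
    simp only [hGdef, add_zero]; ring_nf
  rw [← e]; exact hmv

/-! ### The prime-sum part of the carrier cell is exact -/

/-- **The kink at `log n` is interior to the carrier cell, all other kinks are outside.**  For
`n ≥ 2`, `1 ≤ j ≤ n`, `r ≥ n` and `M = n r + j` (so `⌈M/n⌉ = r + 1`):
`φ(log(M/r)) + φ(log((M−1)/(r+1))) − φ(log(M/(r+1))) − φ(log((M−1)/r)) = (Λ(n)/√n)·log(M/(M−1))`
(`φ = zetaScrewPrimeSum`; the whole hinge mass sits on the single increment `I_{⌈M/n⌉}` — it is never
split). [folklore] -/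
theorem primeSum_mixed_eq {n j r : ℕ} (hn : 2 ≤ n) (hj1 : 1 ≤ j) (hjn : j ≤ n) (hr : n ≤ r) :
    zetaScrewPrimeSum (Real.log (((n : ℝ) * r + j) / (r : ℝ)))
      + zetaScrewPrimeSum (Real.log (((n : ℝ) * r + j - 1) / ((r : ℝ) + 1)))
      - zetaScrewPrimeSum (Real.log (((n : ℝ) * r + j) / ((r : ℝ) + 1)))
      - zetaScrewPrimeSum (Real.log (((n : ℝ) * r + j - 1) / (r : ℝ)))
    = ArithmeticFunction.vonMangoldt n / Real.sqrt n
        * Real.log (((n : ℝ) * r + j) / ((n : ℝ) * r + j - 1)) := by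
  obtain ⟨k, rfl⟩ : ∃ k, n = k + 1 := ⟨n - 1, by omega⟩
  have hk1 : 1 ≤ k := by omega
  set N : ℝ := ((k + 1 : ℕ) : ℝ) with hN
  have hn' : (2 : ℝ) ≤ N := by rw [hN]; exact_mod_cast hn
  have hr' : N ≤ (r : ℝ) := by rw [hN]; exact_mod_cast hr
  have hj1' : (1 : ℝ) ≤ (j : ℝ) := by exact_mod_cast hj1
  have hjn' : (j : ℝ) ≤ N := by rw [hN]; exact_mod_cast hjn
  have hr0 : 0 < (r : ℝ) := by linarith
  have hr1 : 0 < (r : ℝ) + 1 := by linarith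
  have hM1 : 0 < N * r + j - 1 := by nlinarith
  have hM0 : 0 < N * r + j := by linarith
  -- the four points
  set P1 : ℝ := Real.log ((N * r + j) / (r : ℝ)) with hP1
  set P2 : ℝ := Real.log ((N * r + j - 1) / ((r : ℝ) + 1)) with hP2
  set P3 : ℝ := Real.log ((N * r + j) / ((r : ℝ) + 1)) with hP3
  set P4 : ℝ := Real.log ((N * r + j - 1) / (r : ℝ)) with hP4
  have hcastN : ((k + 1 : ℕ) : ℝ) = N := rfl
  have hcastk : ((k : ℕ) : ℝ) = N - 1 := by rw [hN]; push_cast; ring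
  -- gap memberships: P1, P4 ∈ [log N, log(N+1)], P2, P3 ∈ [log(N−1), log N]
  have hP1lo : Real.log ((k + 1 : ℕ) : ℝ) ≤ P1 := by
    rw [hcastN, hP1]; apply Real.log_le_log (by positivity)
    rw [le_div_iff₀ hr0]; nlinarith
  have hP1hi : P1 ≤ Real.log (((k + 1 : ℕ) : ℝ) + 1) := by
    rw [hcastN, hP1]; apply Real.log_le_log (by positivity)
    rw [div_le_iff₀ hr0]; nlinarith
  have hP4lo : Real.log ((k + 1 : ℕ) : ℝ) ≤ P4 := by
    rw [hcastN, hP4]; apply Real.log_le_log (by positivity)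
    rw [le_div_iff₀ hr0]; nlinarith
  have hP4hi : P4 ≤ Real.log (((k + 1 : ℕ) : ℝ) + 1) := by
    rw [hcastN, hP4]; apply Real.log_le_log (by positivity)
    rw [div_le_iff₀ hr0]; nlinarith
  have hP2lo : Real.log ((k : ℕ) : ℝ) ≤ P2 := by
    rw [hcastk, hP2]; apply Real.log_le_log (by linarith)
    rw [le_div_iff₀ hr1]; nlinarith
  have hP2hi : P2 ≤ Real.log (((k : ℕ) : ℝ) + 1) := by
    rw [hcastk, hP2, sub_add_cancel]; apply Real.log_le_log (by positivity)
    rw [div_le_iff₀ hr1]; nlinarith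
  have hP3lo : Real.log ((k : ℕ) : ℝ) ≤ P3 := by
    rw [hcastk, hP3]; apply Real.log_le_log (by linarith)
    rw [le_div_iff₀ hr1]; nlinarith
  have hP3hi : P3 ≤ Real.log (((k : ℕ) : ℝ) + 1) := by
    rw [hcastk, hP3, sub_add_cancel]; apply Real.log_le_log (by positivity)
    rw [div_le_iff₀ hr1]; nlinarith
  -- evaluate φ on the gaps
  rw [zetaScrewPrimeSum_eq_of_mem_Icc (N := k + 1) (by omega) hP1lo hP1hi,
    zetaScrewPrimeSum_eq_of_mem_Icc (N := k) hk1 hP2lo hP2hi,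
    zetaScrewPrimeSum_eq_of_mem_Icc (N := k) hk1 hP3lo hP3hi,
    zetaScrewPrimeSum_eq_of_mem_Icc (N := k + 1) (by omega) hP4lo hP4hi]
  simp only [Finset.sum_Icc_succ_top (show 1 ≤ k + 1 by omega)]
  -- the exact relation P1 + P2 = P3 + P4, and P1 − P4 = log(M/(M−1))
  have hsum : P1 + P2 = P3 + P4 := by
    rw [hP1, hP2, hP3, hP4, Real.log_div hM0.ne' hr0.ne', Real.log_div hM1.ne' hr1.ne',
      Real.log_div hM0.ne' hr1.ne', Real.log_div hM1.ne' hr0.ne']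
    ring
  have hP14 : P1 - P4 = Real.log ((N * r + j) / (N * r + j - 1)) := by
    rw [hP1, hP4, Real.log_div hM0.ne' hr0.ne', Real.log_div hM1.ne' hr0.ne',
      Real.log_div hM0.ne' hM1.ne']
    ring
  -- Σ_{m ≤ k} c_m (P1 + P2 − P3 − P4) = 0
  have hzero : ∑ m ∈ Icc 1 k, ArithmeticFunction.vonMangoldt m / Real.sqrt m * (P1 - Real.log m)
      + ∑ m ∈ Icc 1 k, ArithmeticFunction.vonMangoldt m / Real.sqrt m * (P2 - Real.log m)
      - ∑ m ∈ Icc 1 k, ArithmeticFunction.vonMangoldt m / Real.sqrt m * (P3 - Real.log m)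
      - ∑ m ∈ Icc 1 k, ArithmeticFunction.vonMangoldt m / Real.sqrt m * (P4 - Real.log m) = 0 := by
    rw [← Finset.sum_add_distrib, ← Finset.sum_sub_distrib, ← Finset.sum_sub_distrib]
    refine Finset.sum_eq_zero fun m _ => ?_
    have : P1 - Real.log m + (P2 - Real.log m) - (P3 - Real.log m) - (P4 - Real.log m)
        = (P1 + P2) - (P3 + P4) := by ring
    rw [← mul_add, ← mul_sub, ← mul_sub, this, hsum, sub_self, mul_zero]
  have hfinal : ArithmeticFunction.vonMangoldt ((k + 1 : ℕ)) / Real.sqrt ((k + 1 : ℕ) : ℝ)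
        * (P1 - Real.log ((k + 1 : ℕ) : ℝ))
      - ArithmeticFunction.vonMangoldt ((k + 1 : ℕ)) / Real.sqrt ((k + 1 : ℕ) : ℝ)
        * (P4 - Real.log ((k + 1 : ℕ) : ℝ))
      = ArithmeticFunction.vonMangoldt ((k + 1 : ℕ)) / Real.sqrt ((k + 1 : ℕ) : ℝ)
        * Real.log ((N * r + j) / (N * r + j - 1)) := by
    rw [← hP14]; ring
  linear_combination hzero + hfinal

/-! ### The hinge covariance -/

/-- `r ↦ n·r + j` tends to infinity for `n ≥ 1`. [folklore] -/
private theorem tendsto_const_mul_add_nat {n : ℕ} (hn : 1 ≤ n) (j : ℕ) :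
    Tendsto (fun r : ℕ => n * r + j) atTop atTop :=
  Filter.tendsto_atTop_mono (fun r => (Nat.le_mul_of_pos_left r (by omega)).trans
    (Nat.le_add_right _ _)) tendsto_id

/-- **THE HINGE RESONANCE.**  For every `n ≥ 2` and `1 ≤ j ≤ n`, as `r → ∞` with `M = n r + j`
(so that `⌈M/n⌉ = r + 1`; `j = n` is the case `n ∣ M`):
`M·(Ψ(log(M/r)) + Ψ(log((M−1)/(r+1))) − Ψ(log(M/(r+1))) − Ψ(log((M−1)/r))) → −Λ(n)/√n`,
i.e. `M·Cov(I_M, I_{⌈M/n⌉}) → −Λ(n)/√n` (`0` unless `n` is a prime power).  Running `j` over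
`1, …, n` covers every residue class of `M` modulo `n`. [folklore] -/
theorem tendsto_hingeCov {n j : ℕ} (hn : 2 ≤ n) (hj1 : 1 ≤ j) (hjn : j ≤ n) :
    Tendsto (fun r : ℕ => ((n : ℝ) * r + j) *
        (zetaScrew (Real.log (((n : ℝ) * r + j) / (r : ℝ)))
          + zetaScrew (Real.log (((n : ℝ) * r + j - 1) / ((r : ℝ) + 1)))
          - zetaScrew (Real.log (((n : ℝ) * r + j) / ((r : ℝ) + 1)))
          - zetaScrew (Real.log (((n : ℝ) * r + j - 1) / (r : ℝ)))))
      atTop (𝓝 (-(ArithmeticFunction.vonMangoldt n / Real.sqrt n))) := by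
  set c : ℝ := ArithmeticFunction.vonMangoldt n / Real.sqrt n with hc
  set ℓ : ℝ := Real.log (n : ℝ) with hℓ
  have hn' : (2 : ℝ) ≤ (n : ℝ) := by exact_mod_cast hn
  have hj1' : (1 : ℝ) ≤ (j : ℝ) := by exact_mod_cast hj1
  have hjn' : (j : ℝ) ≤ (n : ℝ) := by exact_mod_cast hjn
  have hℓ0 : 0 < ℓ := Real.log_pos (by linarith)
  -- (1) M·log(M/(M−1)) → 1 along M = n r + j
  have hMb : Tendsto (fun r : ℕ => ((n : ℝ) * r + j) *
      Real.log (((n : ℝ) * r + j) / ((n : ℝ) * r + j - 1))) atTop (𝓝 1) := by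
    have h := (tendsto_mul_log_div_sub 1).comp (tendsto_const_mul_add_nat (by omega : 1 ≤ n) j)
    refine h.congr fun r => ?_
    simp only [Function.comp_apply, Nat.cast_add, Nat.cast_mul]
  -- (2) the wall part: M·ΔW → 0 (ε-argument)
  have hW : Tendsto (fun r : ℕ => ((n : ℝ) * r + j) *
      (wallPsi (Real.log (((n : ℝ) * r + j) / (r : ℝ)))
        + wallPsi (Real.log (((n : ℝ) * r + j - 1) / ((r : ℝ) + 1)))
        - wallPsi (Real.log (((n : ℝ) * r + j) / ((r : ℝ) + 1)))
        - wallPsi (Real.log (((n : ℝ) * r + j - 1) / (r : ℝ))))) atTop (𝓝 0) := by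
    rw [Metric.tendsto_atTop]
    intro ε hε
    obtain ⟨δ, hδ, hδW⟩ := wallPsi_mixed_le hℓ0 (show 0 < ε / (4 * n) by positivity)
    -- eventually 1/r ≤ δ (all three small quantities are ≤ 1/r) and r ≥ n
    have hsmall : ∀ᶠ r : ℕ in atTop, (1 : ℝ) / (r : ℝ) ≤ δ ∧ (n : ℝ) ≤ r := by
      have h1 : Tendsto (fun r : ℕ => (1 : ℝ) / (r : ℝ)) atTop (𝓝 0) :=
        tendsto_const_nhds.div_atTop tendsto_natCast_atTop_atTop
      filter_upwards [h1.eventually (gt_mem_nhds hδ), eventually_ge_atTop n] with r h hr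
      exact ⟨h.le, by exact_mod_cast hr⟩
    obtain ⟨R, hR⟩ := eventually_atTop.1 hsmall
    refine ⟨R, fun r hr => ?_⟩
    obtain ⟨hrδ, hrn⟩ := hR r hr
    have hr0 : 0 < (r : ℝ) := by linarith
    have hr1 : 0 < (r : ℝ) + 1 := by linarith
    have hM1 : 0 < (n : ℝ) * r + j - 1 := by nlinarith
    have hM0 : 0 < (n : ℝ) * r + j := by linarith
    -- x, a, b
    set x : ℝ := Real.log (((n : ℝ) * r + j) / ((r : ℝ) + 1)) with hx
    set a : ℝ := Real.log (((r : ℝ) + 1) / (r : ℝ)) with ha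
    set b : ℝ := Real.log (((n : ℝ) * r + j) / ((n : ℝ) * r + j - 1)) with hb
    have ha0 : 0 ≤ a := Real.log_nonneg (by rw [le_div_iff₀ hr0]; linarith)
    have hale : a ≤ 1 / (r : ℝ) := by
      have := Real.log_le_sub_one_of_pos (show 0 < ((r : ℝ) + 1) / (r : ℝ) by positivity)
      have e : ((r : ℝ) + 1) / (r : ℝ) - 1 = 1 / (r : ℝ) := by field_simp; ring
      linarith
    have hb0 : 0 ≤ b := Real.log_nonneg (by rw [le_div_iff₀ hM1]; linarith)
    have hble : b ≤ 1 / (r : ℝ) := by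
      have := Real.log_le_sub_one_of_pos (show 0 < ((n : ℝ) * r + j) / ((n : ℝ) * r + j - 1) by positivity)
      have e : ((n : ℝ) * r + j) / ((n : ℝ) * r + j - 1) - 1 = 1 / ((n : ℝ) * r + j - 1) := by
        field_simp; ring
      have hmono : 1 / ((n : ℝ) * r + j - 1) ≤ 1 / (r : ℝ) :=
        one_div_le_one_div_of_le hr0 (by nlinarith)
      linarith
    have hxℓ : |x - ℓ| ≤ 1 / (r : ℝ) := by
      -- x − ℓ = log((nr+j)/(n(r+1))) ∈ [1 − n(r+1)/(nr+j), 0]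
      have hq0 : 0 < ((n : ℝ) * r + j) / ((n : ℝ) * ((r : ℝ) + 1)) := by positivity
      have hxe : x - ℓ = Real.log (((n : ℝ) * r + j) / ((n : ℝ) * ((r : ℝ) + 1))) := by
        rw [hx, hℓ, Real.log_div hM0.ne' hr1.ne', Real.log_div hM0.ne' (by positivity),
          Real.log_mul (by linarith) hr1.ne']
        ring
      have hle1 : ((n : ℝ) * r + j) / ((n : ℝ) * ((r : ℝ) + 1)) ≤ 1 := by
        rw [div_le_one (by positivity)]; nlinarith
      have hup : x - ℓ ≤ 0 := by rw [hxe]; exact Real.log_nonpos hq0.le hle1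
      have hlo : -(1 / (r : ℝ)) ≤ x - ℓ := by
        rw [hxe]
        have h1 := Real.one_sub_inv_le_log_of_pos hq0
        have e : 1 - (((n : ℝ) * r + j) / ((n : ℝ) * ((r : ℝ) + 1)))⁻¹
            = ((j : ℝ) - n) / ((n : ℝ) * r + j) := by
          field_simp; ring
        rw [e] at h1
        have h2 : -(1 / (r : ℝ)) ≤ ((j : ℝ) - n) / ((n : ℝ) * r + j) := by
          rw [neg_le, ← neg_div, neg_sub, div_le_div_iff₀ hM0 hr0]; nlinarith
        linarith
      rw [abs_le]; exact ⟨hlo, hup.trans (by positivity)⟩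
    -- the four points in terms of x, a, b
    have e1 : Real.log (((n : ℝ) * r + j) / (r : ℝ)) = x + a := by
      rw [hx, ha, Real.log_div hM0.ne' hr0.ne', Real.log_div hM0.ne' hr1.ne',
        Real.log_div hr1.ne' hr0.ne']
      ring
    have e2 : Real.log (((n : ℝ) * r + j - 1) / ((r : ℝ) + 1)) = x - b := by
      rw [hx, hb, Real.log_div hM1.ne' hr1.ne', Real.log_div hM0.ne' hr1.ne',
        Real.log_div hM0.ne' hM1.ne']
      ring
    have e4 : Real.log (((n : ℝ) * r + j - 1) / (r : ℝ)) = x + a - b := by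
      rw [hx, ha, hb, Real.log_div hM1.ne' hr0.ne', Real.log_div hM0.ne' hr1.ne',
        Real.log_div hr1.ne' hr0.ne', Real.log_div hM0.ne' hM1.ne']
      ring
    rw [e1, e2, e4, Real.dist_eq, sub_zero]
    have hΔ := hδW x a b (hxℓ.trans hrδ) ha0 (hale.trans hrδ) hb0 (hble.trans hrδ)
    -- M·a ≤ 2n
    have hMa : ((n : ℝ) * r + j) * a ≤ 2 * n := by
      have h1 : ((n : ℝ) * r + j) * a ≤ ((n : ℝ) * r + j) * (1 / (r : ℝ)) :=
        mul_le_mul_of_nonneg_left hale hM0.le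
      have h2 : ((n : ℝ) * r + j) * (1 / (r : ℝ)) ≤ 2 * n := by
        rw [mul_one_div, div_le_iff₀ hr0]; nlinarith
      linarith
    have hn0 : (0 : ℝ) < n := by linarith
    calc |((n : ℝ) * r + j) * (wallPsi (x + a) + wallPsi (x - b) - wallPsi x - wallPsi (x + a - b))|
        = ((n : ℝ) * r + j) * |wallPsi (x + a) + wallPsi (x - b) - wallPsi x - wallPsi (x + a - b)| := by
          rw [abs_mul, abs_of_pos hM0]
      _ ≤ ((n : ℝ) * r + j) * (ε / (4 * n) * a) := mul_le_mul_of_nonneg_left hΔ hM0.le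
      _ = ε / (4 * n) * (((n : ℝ) * r + j) * a) := by ring
      _ ≤ ε / (4 * n) * (2 * n) := mul_le_mul_of_nonneg_left hMa (by positivity)
      _ = ε / 2 := by field_simp; ring
      _ < ε := by linarith
  -- (3) assemble: Ψ = Ψ_wall − φ at the four (nonnegative) points, φ-part exact
  have hmain := hW.sub (hMb.const_mul c)
  rw [zero_sub, mul_one] at hmain
  refine hmain.congr' ?_
  filter_upwards [eventually_ge_atTop n] with r hr
  have hr' : (n : ℝ) ≤ (r : ℝ) := by exact_mod_cast hr
  have hr0 : 0 < (r : ℝ) := by linarith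
  have hr1 : 0 < (r : ℝ) + 1 := by linarith
  have hM1 : 0 < (n : ℝ) * r + j - 1 := by nlinarith
  have hM0 : 0 < (n : ℝ) * r + j := by linarith
  have hp1 : 0 ≤ Real.log (((n : ℝ) * r + j) / (r : ℝ)) :=
    Real.log_nonneg (by rw [le_div_iff₀ hr0]; nlinarith)
  have hp2 : 0 ≤ Real.log (((n : ℝ) * r + j - 1) / ((r : ℝ) + 1)) :=
    Real.log_nonneg (by rw [le_div_iff₀ hr1]; nlinarith)
  have hp3 : 0 ≤ Real.log (((n : ℝ) * r + j) / ((r : ℝ) + 1)) :=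
    Real.log_nonneg (by rw [le_div_iff₀ hr1]; nlinarith)
  have hp4 : 0 ≤ Real.log (((n : ℝ) * r + j - 1) / (r : ℝ)) :=
    Real.log_nonneg (by rw [le_div_iff₀ hr0]; nlinarith)
  have hφ := primeSum_mixed_eq hn hj1 hjn hr
  rw [zetaScrew_eq_wallPsi_sub_primeSum hp1, zetaScrew_eq_wallPsi_sub_primeSum hp2,
    zetaScrew_eq_wallPsi_sub_primeSum hp3, zetaScrew_eq_wallPsi_sub_primeSum hp4]
  rw [← hc] at hφ
  linear_combination ((n : ℝ) * r + j) * hφ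

/-- **The divisible case** (`j = n`, re-indexed): for `n ≥ 2`, as `r → ∞` with `M = n r`,
`M·(Ψ(log(M/(r−1))) + Ψ(log((M−1)/r)) − Ψ(log(M/r)) − Ψ(log((M−1)/(r−1)))) → −Λ(n)/√n`, i.e.
`M·Cov(I_M, I_{M/n}) → −Λ(n)/√n` along `n ∣ M` (PIVOT-LAW §2d: «when q ∣ M the whole mass sits on
I_{M/q}»). [folklore] -/
theorem tendsto_hingeCov_dvd {n : ℕ} (hn : 2 ≤ n) :
    Tendsto (fun r : ℕ => ((n : ℝ) * r) *
        (zetaScrew (Real.log (((n : ℝ) * r) / ((r : ℝ) - 1)))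
          + zetaScrew (Real.log (((n : ℝ) * r - 1) / (r : ℝ)))
          - zetaScrew (Real.log (((n : ℝ) * r) / (r : ℝ)))
          - zetaScrew (Real.log (((n : ℝ) * r - 1) / ((r : ℝ) - 1)))))
      atTop (𝓝 (-(ArithmeticFunction.vonMangoldt n / Real.sqrt n))) := by
  have h := (tendsto_hingeCov (j := n) hn (by omega) le_rfl).comp (tendsto_sub_atTop_nat 1)
  refine h.congr' ?_
  filter_upwards [eventually_ge_atTop 1] with r hr
  have hcast : ((r - 1 : ℕ) : ℝ) = (r : ℝ) - 1 := by rw [Nat.cast_sub hr, Nat.cast_one]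
  simp only [Function.comp_apply, hcast]
  have e : (n : ℝ) * ((r : ℝ) - 1) + n = (n : ℝ) * r := by ring
  rw [e, sub_add_cancel]

end Summit.RiemannHypothesis.RiemannHypothesis.Theorems.IntegerScrew
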